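import Summits.CriticalPhenomena.PercolationContinuityZ3.Theorems.PercShatteringRaceNearLinearTwoClusterDecayStubLossyStep
import Summits.CriticalPhenomena.PercolationContinuityZ3.Theorems.PercShatteringRaceNearLinearTwoClusterDecayJumpAspect48
import HarnessLib

/-!
# Crux `PercShatteringRace.NearLinearTwoClusterDecay` (stmt-CriticalPhenomena-5785) — stub W3 `stub_critAspectOfTwoArm`

Helper file of the line `pair-decay-long-arms-dense` (§ Unconditional frontier); lands with
`--supports stmt-CriticalPhenomena-5785` (registered stub `stub_critAspectOfTwoArm`).

## Statement

At `p = p_c(ℤ³)` (bond percolation), unconditionally (no `θ(p_c) > 0` hypothesis): a critical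
pair-connection lower bound W1 (`P(a ↔ b inside Λ_{2n}) ≥ c n^{-12}` for all `a, b ∈ Λ_n`, `n ≥ 1`)
and a two-arms exponent `κ > 0` (`P(edgeTwoArms i m) ≤ C m^{-κ}` for `m ≥ 1`) give, for every aspect
exponent `A > 1` with `κ A > 24`, that the crux event at exponent `A` — two sites `x, x' ∈ Λ_n` each
joined inside `Λ_N` to `∂ⁱⁿΛ_N` but not to each other inside `Λ_N`, `N = ⌈n^A⌉` — has probability
tending to `0`.  The hypothesis `1 < A` is load-bearing: at exponent `≤ 1` the event keeps probability
`≥ (1 - p_c)^6` (`NearLinearTwoClusterDecay.Negative.not_atExponent_of_le_one`).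

## Proof sketch

Write `N = ⌈n^A⌉₊`, `P = P_{p_c}`.
* The crux event is contained in the complement `(uniqZone n N)ᶜ` of the uniqueness zone (both are
  "some pair of `Λ_n` reaches `∂ⁱⁿΛ_N` inside `Λ_N` without being joined inside `Λ_N`";
  `twoCluster_subset_compl_uniqZone`).
* Cerf 2015, Corollary 7.2 + Lemma 7.1 (bond), divided by the pair-connection lower bound and counted
  (`NearLinearTwoClusterDecayLossyStep.real_compl_uniqZone_le_poly` with middle radius `m = 2n` and
  `δ = c n^{-12}`, valid once `2n + 3 ≤ N`):
  `P((uniqZone n N)ᶜ) ≤ (2n+1)⁶ (1 + 6/p_c) (4n+3)⁶ · 3C (N − 2n − 2)^{−κ} / (c n^{−12})`.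
* Real analysis (`NearLinearTwoClusterDecayLossyStep.poly_bound` with `U = n`, `P = mr = 2n`,
  `Q = n^A ≤ N`; `eventually_one_le_and_sixteen_mul_le`: eventually `16 n ≤ n^A`, whence
  `2n + 3 ≤ N` and `N − 2n − 2 ≥ n^A / 2`; `collect_rpow`): the bound is `≤ K n^{24 − κA}` with
  `K = 3⁶ 7⁶ · 3 · 2^κ (1 + 6/p_c) C · 2⁶ / c`, and `n^{24 − κA} → 0` as `κA > 24`
  (`tendsto_rpow_neg_atTop`); conclude by `squeeze_zero'` (`p_c > 0` by
  `Grimmett1999_criticalProb_pos_lt_one_holds`).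

## References

* R. Cerf, *A lower bound on the two-arms exponent for critical percolation on the lattice*, Ann. Probab. 43
  (2015), §7, Lemma 7.1 and Corollary 7.2 (arXiv:1306.3105 pp. 11–13) [Cerf2015].
* H. Duminil-Copin, G. Kozma, V. Tassion, arXiv:1902.03207, §7 [DuminilcopinKozmaTassion2020].
-/

noncomputable section

namespace Summit.CriticalPhenomena.PercolationContinuityZ3.Theorems

namespace NearLinearTwoClusterDecayCritAspect

open MeasureTheory Filter Topology
open Literature.Probability.LatticeModels Literature.Probability.Percolation

variable {d : ℕ}

/-! ## The crux event sits inside the complement of the uniqueness zone -/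

/-- **The two-cluster event is a failure of the uniqueness zone**: if `x, x' ∈ Λ_k` are joined inside
`Λ_m` to `∂ⁱⁿΛ_m` but not to each other inside `Λ_m`, then `ω ∉ uniqZone k m` (the two events are in
fact equal; only this inclusion is used). [folklore] -/
theorem twoCluster_subset_compl_uniqZone (k m : ℕ) :
    {ω : BondConfig (Site d) | ∃ x ∈ box d k, ∃ x' ∈ box d k,
      ∃ y ∈ innerBoundary (zdGraph d) (box d m), ∃ y' ∈ innerBoundary (zdGraph d) (box d m),
        ω ∈ openConnIn ↑(box d m) x y ∧ ω ∈ openConnIn ↑(box d m) x' y' ∧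
        ω ∉ openConnIn ↑(box d m) x x'} ⊆ (uniqZone (d := d) k m)ᶜ := by
  rintro ω ⟨x, hx, x', hx', y, hy, y', hy', hxy, hx'y', hxx'⟩ hU
  exact hxx' (hU x hx x' hx' ⟨y, hy, hxy⟩ ⟨y', hy', hx'y'⟩)

/-! ## Real analysis -/

/-- **The two scales separate**: for `A > 1`, eventually in `u : ℕ`, `1 ≤ u` and `16 u ≤ u^A`
(since `u^{A−1} → ∞`). [folklore] -/
theorem eventually_one_le_and_sixteen_mul_le {A : ℝ} (hA : 1 < A) :
    ∀ᶠ u : ℕ in atTop, 1 ≤ u ∧ 16 * (u : ℝ) ≤ (u : ℝ) ^ A := by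
  have hev : ∀ᶠ u : ℕ in atTop, (16 : ℝ) ≤ (u : ℝ) ^ (A - 1) :=
    ((tendsto_rpow_atTop (by linarith : 0 < A - 1)).comp tendsto_natCast_atTop_atTop).eventually_ge_atTop
      16
  filter_upwards [hev, eventually_ge_atTop 1] with u hu hu1
  refine ⟨hu1, ?_⟩
  have hU1 : (1 : ℝ) ≤ u := Nat.one_le_cast.2 hu1
  have hU : (0 : ℝ) < u := by linarith
  have hsplit : (u : ℝ) ^ A = (u : ℝ) ^ (1 : ℝ) * (u : ℝ) ^ (A - 1) := by
    rw [← Real.rpow_add hU]; congr 1; ring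
  rw [hsplit, Real.rpow_one]
  calc 16 * (u : ℝ) = (u : ℝ) * 16 := by ring
    _ ≤ (u : ℝ) * (u : ℝ) ^ (A - 1) := mul_le_mul_of_nonneg_left hu hU.le

/-- **Collecting the powers** against the pair-connection lower bound `δ = c t^{-12}`:
`(3⁶ 7⁶ 3 · 2^κ q C / (c t^{−12})) · t⁶ (2t)⁶ (t^A)^{−κ} = (3⁶ 7⁶ 3 · 2^κ q C 2⁶ / c) · t^{24 − κA}`
for `t > 0`. [folklore] -/
theorem collect_rpow {t c κ A q C : ℝ} (ht : 0 < t) :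
    3 ^ 6 * 7 ^ 6 * 3 * 2 ^ κ * q * C / (c * t ^ (-(12 : ℝ))) *
        (t ^ (6 : ℕ) * (2 * t) ^ (6 : ℕ) * (t ^ A) ^ (-κ)) =
      3 ^ 6 * 7 ^ 6 * 3 * 2 ^ κ * q * C * 2 ^ 6 / c * t ^ (24 - κ * A) := by
  have e1 : t ^ (-(12 : ℝ)) = (t ^ (12 : ℕ))⁻¹ := by
    rw [Real.rpow_neg ht.le]; congr 1; exact_mod_cast Real.rpow_natCast t 12
  have e2 : (t ^ A) ^ (-κ) = t ^ (-(κ * A)) := by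
    rw [← Real.rpow_mul ht.le]; congr 1; ring
  have e3 : t ^ (24 - κ * A) = t ^ (24 : ℕ) * t ^ (-(κ * A)) := by
    rw [sub_eq_add_neg, Real.rpow_add ht]; congr 1; exact_mod_cast Real.rpow_natCast t 24
  rw [e1, e2, e3]
  simp only [div_eq_mul_inv, mul_inv, inv_inv]
  ring

end NearLinearTwoClusterDecayCritAspect

open MeasureTheory Filter Topology
open Literature.Probability.LatticeModels Literature.Probability.Percolation
open NearLinearTwoClusterDecayLossyStep NearLinearTwoClusterDecayCritAspect

/-- **Stub W3 `stub_critAspectOfTwoArm` of the line `pair-decay-long-arms-dense`** (registered; § Unconditional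
frontier): at `p_c(ℤ³)`, a critical pair-connection lower bound `P(a ↔ b inside Λ_{2n}) ≥ c n^{-12}` on
`Λ_n²` (W1) and a two-arms exponent `κ` give two-cluster decay at every aspect exponent `A > 1` with
`κ A > 24` — Cerf 2015 Lemma 7.1 + Corollary 7.2 (bond) with middle box `Λ_{2n}`, the count
`(2n+1)⁶ (1 + 6/p_c)(4n+3)⁶ · 3C (N − 2n − 2)^{−κ} / (c n^{−12}) ≤ K n^{24 − κA} → 0`.
[cite: Cerf2015, Lemma 7.1 and Cor 7.2] -/
theorem stub_critAspectOfTwoArm :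
    (∃ c : ℝ, 0 < c ∧ ∀ n : ℕ, 1 ≤ n → ∀ a ∈ box 3 n, ∀ b ∈ box 3 n,
      c * (n : ℝ) ^ (-(12 : ℝ)) ≤
        (bondPercolation (zdGraph 3) (criticalProbI 3)).real (openConnIn (↑(box 3 (2 * n)) : Set (Site 3)) a b)) →
    ∀ κ : ℝ, 0 < κ →
    (∃ C : ℝ, ∀ i : Fin 3, ∀ m : ℕ, 1 ≤ m →
      (bondPercolation (zdGraph 3) (criticalProbI 3)).real (AKN.edgeTwoArms i m) ≤ C * (m : ℝ) ^ (-κ)) →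
    ∀ A : ℝ, 1 < A → 24 < κ * A →
    Filter.Tendsto (fun n : ℕ => (bondPercolation (zdGraph 3) (criticalProbI 3)).real
      {ω | ∃ x ∈ box 3 n, ∃ x' ∈ box 3 n, ∃ y ∈ innerBoundary (zdGraph 3) (box 3 ⌈(n : ℝ) ^ A⌉₊),
        ∃ y' ∈ innerBoundary (zdGraph 3) (box 3 ⌈(n : ℝ) ^ A⌉₊),
          ω ∈ openConnIn ↑(box 3 ⌈(n : ℝ) ^ A⌉₊) x y ∧
          ω ∈ openConnIn ↑(box 3 ⌈(n : ℝ) ^ A⌉₊) x' y' ∧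
          ω ∉ openConnIn ↑(box 3 ⌈(n : ℝ) ^ A⌉₊) x x'}) Filter.atTop (nhds 0) := by
  intro hW1 κ hκ hTA A hA1 hκA
  obtain ⟨c, hc, hW⟩ := hW1
  obtain ⟨C, hC⟩ := hTA
  have hp0 : 0 < ((criticalProbI 3 : unitInterval) : ℝ) := by
    rw [coe_criticalProbI]
    exact (Grimmett1999_criticalProb_pos_lt_one_holds 3 (by norm_num)).1
  have hC0 : 0 ≤ C := by
    have h := hC 0 1 le_rfl
    rw [Nat.cast_one, Real.one_rpow, mul_one] at h
    exact measureReal_nonneg.trans h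
  obtain ⟨q, hq⟩ : ∃ q : ℝ, q = 1 + 6 / ((criticalProbI 3 : unitInterval) : ℝ) := ⟨_, rfl⟩
  have hq0 : 0 ≤ q := by rw [hq]; positivity
  obtain ⟨K, hK⟩ : ∃ K : ℝ, K = 3 ^ 6 * 7 ^ 6 * 3 * 2 ^ κ * q * C * 2 ^ 6 / c := ⟨_, rfl⟩
  -- the comparison sequence `K n^{24 - κA} → 0`
  have hlim : Tendsto (fun n : ℕ => K * (n : ℝ) ^ (24 - κ * A)) atTop (𝓝 0) := by
    have h1 : Tendsto (fun n : ℕ => (n : ℝ) ^ (24 - κ * A)) atTop (𝓝 0) := by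
      have e : 24 - κ * A = -(κ * A - 24) := by ring
      rw [e]
      exact (tendsto_rpow_neg_atTop (by linarith)).comp tendsto_natCast_atTop_atTop
    simpa only [mul_zero] using h1.const_mul K
  refine squeeze_zero' (Eventually.of_forall fun n => measureReal_nonneg) ?_ hlim
  filter_upwards [eventually_one_le_and_sixteen_mul_le hA1] with n hn
  obtain ⟨hn1, h16⟩ := hn
  -- bookkeeping at a good scale `n`: `1 ≤ n`, `16 n ≤ n^A ≤ N`
  have hU1 : (1 : ℝ) ≤ n := Nat.one_le_cast.2 hn1
  have hU0 : (0 : ℝ) < n := by linarith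
  have hδ : 0 < c * (n : ℝ) ^ (-(12 : ℝ)) := mul_pos hc (Real.rpow_pos_of_pos hU0 _)
  have hmr : ((2 * n : ℕ) : ℝ) = 2 * (n : ℝ) := by push_cast; ring
  have hM1 : (n : ℝ) ^ A ≤ (⌈(n : ℝ) ^ A⌉₊ : ℕ) := Nat.le_ceil _
  have hnm : n ≤ 2 * n := by omega
  have hmM : 2 * n + 3 ≤ ⌈(n : ℝ) ^ A⌉₊ := by
    have h : ((2 * n : ℕ) : ℝ) + 3 ≤ (⌈(n : ℝ) ^ A⌉₊ : ℕ) := by rw [hmr]; linarith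
    exact_mod_cast h
  calc (bondPercolation (zdGraph 3) (criticalProbI 3)).real
        {ω | ∃ x ∈ box 3 n, ∃ x' ∈ box 3 n, ∃ y ∈ innerBoundary (zdGraph 3) (box 3 ⌈(n : ℝ) ^ A⌉₊),
          ∃ y' ∈ innerBoundary (zdGraph 3) (box 3 ⌈(n : ℝ) ^ A⌉₊),
            ω ∈ openConnIn ↑(box 3 ⌈(n : ℝ) ^ A⌉₊) x y ∧
            ω ∈ openConnIn ↑(box 3 ⌈(n : ℝ) ^ A⌉₊) x' y' ∧
            ω ∉ openConnIn ↑(box 3 ⌈(n : ℝ) ^ A⌉₊) x x'}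
      ≤ (bondPercolation (zdGraph 3) (criticalProbI 3)).real (@uniqZone 3 n ⌈(n : ℝ) ^ A⌉₊)ᶜ :=
        measureReal_mono (twoCluster_subset_compl_uniqZone n _) (measure_ne_top _ _)
    _ ≤ (2 * (n : ℝ) + 1) ^ 6 * ((1 + 6 / ((criticalProbI 3 : unitInterval) : ℝ)) *
          (2 * ((2 * n : ℕ) : ℝ) + 3) ^ 6 *
            (3 * C * (((⌈(n : ℝ) ^ A⌉₊ : ℕ) : ℝ) - ((2 * n : ℕ) : ℝ) - 2) ^ (-κ))) /
          (c * (n : ℝ) ^ (-(12 : ℝ))) :=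
        real_compl_uniqZone_le_poly (criticalProbI 3) hp0 hδ hC0 hC hnm hmM (hW n hn1)
    _ ≤ 3 ^ 6 * 7 ^ 6 * 3 * 2 ^ κ * q * C / (c * (n : ℝ) ^ (-(12 : ℝ))) *
          ((n : ℝ) ^ (6 : ℕ) * (2 * (n : ℝ)) ^ (6 : ℕ) * ((n : ℝ) ^ A) ^ (-κ)) := by
        rw [hq]
        exact poly_bound hU1 (by linarith) hmr.ge (by rw [hmr]; linarith) hM1 (by linarith) (hq ▸ hq0)
          hC0 hδ hκ.le
    _ = K * (n : ℝ) ^ (24 - κ * A) := by rw [hK]; exact collect_rpow hU0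

end Summit.CriticalPhenomena.PercolationContinuityZ3.Theorems
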